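import Literature.Computability.Complexity.SumcheckPolyArith
import Literature.Computability.Complexity.ExpPadding
import Literature.Computability.Complexity.SplitOnesBricks
import Literature.Computability.Complexity.SumcheckMAGame
import HarnessLib

/-!
# The honest sumcheck prover runs in exponential time: `HonestLang ∈ EXP`

Sixth file of the sumcheck development. The bit-graph language `SumcheckMA.HonestLang` of the honest
prover of the protocol for `SAT̄` (`SumcheckMASpec.lean`: bit `j` of the fixed-width code of the
polynomial `h(X) = ∑_{b ∈ {0,1}^t} P_φ(r₁, …, rᵢ, X, b)` of Arora–Barak's (8.9), read off the query
`⟨⟨w, coin prefix⟩, 1ʲ⟩`) is in `EXP`. Arora–Barak, §8.4: the prover of the `#SAT_D` protocol needs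
"at the very least to be able to compute `#SAT_D`"; conversely a `2^{poly}`-time computation
obviously suffices, and that is what is formalised: by the padding principle
(`ExpPadding.mem_EXP_of_expPad`: a language is in `EXP` as soon as some polynomial-time machine
decides it on the exponentially padded inputs `1^{2^{|s|²}} 0 s`) it is enough to compute the bit
in time polynomial in the PAD, i.e. with the pad as the budget of the loop over the `2^t ≤ 2^{|s|²}`
points of the cube.

* `litP`/`clauseP`/`cnfP` — the arithmetization `P_φ` at the point with a hole (`Sumcheck.ptX`) as
  an explicit coefficient list (`SumcheckPolyArith.lean`), `ofCoeffs_cnfP`;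
* `natBits`, `cubeSum_eq_sum_range` — the Boolean cube enumerated by a binary counter;
* `hP` — `h` as a coefficient list (`ofCoeffs_hP`), `msgBits` — its fixed-width code computed with
  `div`/`mod` (`msgBits_eq_encodeCoeffs`), `honestCore`/`honestBitB` — the honest bit computed with a
  budget, equal to `honestBit` as soon as the budget has length `≥ 2^{|s|²}` (`honestBitB_eq`);
* the `CodeFP` program `honestCoreC` and the untyped parse of the pad (`onesPrefixFn`/`afterZeroFn`,
  `SplitOnesBricks.lean`), `exists_honestPadFn`, `HonestPad ∈ P`;
* **`honestLang_mem_EXP : HonestLang ∈ EXP`**, and the discharge-level corollary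
  **`UNSAT_mem_MA_of_EXP_subset_PPoly : EXP ⊆ P/poly → UNSAT ∈ MA`** (with `SumcheckMAGame.lean`).

## References

* S. Arora, B. Barak, *Computational Complexity: A Modern Approach*, CUP 2009, §8.3.2 ((8.9): the
  honest polynomial `h`), §8.4 item 2 (power needed by the prover of the `#SAT_D` protocol), §2.6.2 /
  Thm. 2.22 (padding), §1.3.
-/

noncomputable section

namespace Literature.Computability.Complexity

open _root_.Computability Polynomial Brick Sumcheck CodeFP Finset

namespace SumcheckMA

/-! ### `P_φ` at the point with a hole, as a coefficient list -/

/-- `1 - p` on coefficient lists. [folklore] -/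
def oneSubP (p : List ℤ) : List ℤ := padd [1] (pscale (-1) p)

/-- `ofCoeffs (1 ⊖ p) = 1 - ofCoeffs p`. [folklore] -/
theorem ofCoeffs_oneSubP (p : List ℤ) : ofCoeffs (oneSubP p) = 1 - ofCoeffs p := by
  rw [oneSubP, ofCoeffs_padd, ofCoeffs_pscale, ofCoeffs_singleton]
  simp [sub_eq_add_neg]

/-- The coordinate of variable `v` at the point with a hole (`Sumcheck.ptX`), as a coefficient list:
a fixed integer before the hole, `X` at the hole, a cube bit after it. [cite: AroraBarakCC2009, §8.3.2 ((8.9))] -/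
def coordP (vl : List ℕ) (pref xs : List ℤ) (v : ℕ) : List ℤ :=
  if vl.idxOf v < pref.length then [pref.getD (vl.idxOf v) 0]
  else if vl.idxOf v = pref.length then [0, 1]
  else [xs.getD (vl.idxOf v - pref.length - 1) 0]

/-- `ofCoeffs (coordP …) = ptX …`. [folklore] -/
theorem ofCoeffs_coordP (vl : List ℕ) (pref xs : List ℤ) (v : ℕ) : ofCoeffs (coordP vl pref xs v) = ptX vl pref xs v := by
  unfold coordP ptX
  split_ifs <;> simp

/-- A literal at the point with a hole, as a coefficient list. [cite: AroraBarakCC2009, §8.3.1] -/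
def litP (vl : List ℕ) (pref xs : List ℤ) (l : Literal ℕ) : List ℤ :=
  if l.2 then coordP vl pref xs l.1 else oneSubP (coordP vl pref xs l.1)

/-- `ofCoeffs (litP …) = litVal (ptX …)`. [folklore] -/
theorem ofCoeffs_litP (vl : List ℕ) (pref xs : List ℤ) (l : Literal ℕ) :
    ofCoeffs (litP vl pref xs l) = litVal (ptX vl pref xs) l := by
  unfold litP litVal
  split_ifs <;> simp [ofCoeffs_oneSubP, ofCoeffs_coordP]

/-- A clause at the point with a hole: `1 - ∏ (1 - literal)`. [cite: AroraBarakCC2009, §8.3.1] -/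
def clauseP (vl : List ℕ) (pref xs : List ℤ) (c : Clause ℕ) : List ℤ :=
  oneSubP (pprod (c.map fun l => oneSubP (litP vl pref xs l)))

/-- `ofCoeffs (clauseP …) = clauseVal (ptX …)`. [folklore] -/
theorem ofCoeffs_clauseP (vl : List ℕ) (pref xs : List ℤ) (c : Clause ℕ) :
    ofCoeffs (clauseP vl pref xs c) = clauseVal (ptX vl pref xs) c := by
  unfold clauseP clauseVal
  rw [ofCoeffs_oneSubP, ofCoeffs_pprod, List.map_map]
  congr 2
  refine List.map_congr_left fun l _ => ?_
  simp [ofCoeffs_oneSubP, ofCoeffs_litP]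

/-- **`P_φ` at the point with a hole, as a coefficient list.** [cite: AroraBarakCC2009, §8.3.1] -/
def cnfP (vl : List ℕ) (pref xs : List ℤ) (φ : CNF ℕ) : List ℤ :=
  pprod (φ.map (clauseP vl pref xs))

/-- `ofCoeffs (cnfP …) = cnfVal (ptX …)`. [folklore] -/
theorem ofCoeffs_cnfP (vl : List ℕ) (pref xs : List ℤ) (φ : CNF ℕ) :
    ofCoeffs (cnfP vl pref xs φ) = cnfVal (ptX vl pref xs) φ := by
  unfold cnfP cnfVal
  rw [ofCoeffs_pprod, List.map_map]
  congr 1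
  refine List.map_congr_left fun c _ => ?_
  simp [ofCoeffs_clauseP]

/-! ### The cube by a binary counter -/

/-- The `t` low bits of the counter `c`, as integers `0/1`, least significant first. [folklore] -/
def natBits (t c : ℕ) : List ℤ :=
  (List.range t).map fun j => if c / 2 ^ j % 2 = 1 then (1 : ℤ) else 0

/-- The bijection between bit tuples and counters below `2^t`. [folklore] -/
def tupleEquiv (t : ℕ) : (Fin t → Bool) ≃ Fin (2 ^ t) :=
  (Equiv.arrowCongr (Equiv.refl (Fin t)) finTwoEquiv.symm).trans finFunctionFinEquiv

/-- The tuple of a counter reads its bits. [folklore] -/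
theorem tupleEquiv_symm_apply (t : ℕ) (c : Fin (2 ^ t)) (i : Fin t) :
    ((tupleEquiv t).symm c i = true) ↔ (c : ℕ) / 2 ^ (i : ℕ) % 2 = 1 := by
  unfold tupleEquiv
  simp only [Equiv.symm_trans_apply, Equiv.arrowCongr_symm, Equiv.refl_symm, Equiv.arrowCongr_apply,
    Equiv.coe_refl, Function.comp_apply, Equiv.symm_symm, id_eq]
  rw [show (finFunctionFinEquiv.symm c) i = ⟨(c : ℕ) / 2 ^ (i : ℕ) % 2, Nat.mod_lt _ (by norm_num)⟩ from
    Fin.ext (finFunctionFinEquiv_symm_apply_val c i)]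
  simp [finTwoEquiv, Fin.ext_iff]

/-- `bits` of the tuple of a counter is `natBits`. [folklore] -/
theorem bits_tupleEquiv_symm (t : ℕ) (c : Fin (2 ^ t)) : bits ((tupleEquiv t).symm c) = natBits t c := by
  unfold bits natBits
  apply List.ext_getElem (by simp)
  intro i h1 h2
  rw [List.getElem_ofFn, List.getElem_map, List.getElem_range]
  have hi : i < t := by simpa using h1
  have := tupleEquiv_symm_apply t c ⟨i, hi⟩
  by_cases hb : (tupleEquiv t).symm c ⟨i, hi⟩ = true
  · rw [if_pos hb, if_pos (this.1 hb)]
  · rw [if_neg hb, if_neg (fun h => hb (this.2 h))]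

/-- **The cube sum by a binary counter**: `∑_{b ∈ {0,1}^t} F(b) = ∑_{c < 2^t} F(bits of c)`. [folklore] -/
theorem cubeSum_eq_sum_range {M : Type*} [AddCommMonoid M] (t : ℕ) (F : List ℤ → M) :
    cubeSum t F = ((List.range (2 ^ t)).map fun c => F (natBits t c)).sum := by
  unfold cubeSum
  rw [← Fintype.sum_equiv (tupleEquiv t).symm (fun c => F (natBits t c)) (fun b => F (bits b))
    (fun c => by rw [bits_tupleEquiv_symm])]
  rw [Fin.sum_univ_eq_sum_range (fun c => F (natBits t c)) (2 ^ t), Finset.sum_eq_multiset_sum,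
    Finset.range_val, ← Multiset.coe_range, Multiset.map_coe, Multiset.sum_coe]

/-- `natBits` has length `t`. [folklore] -/
@[simp] theorem length_natBits (t c : ℕ) : (natBits t c).length = t := by simp [natBits]

/-! ### The honest polynomial and its code, with a budget -/

/-- **The honest polynomial `h` as a coefficient list**: the sum of `P_φ` over the cube points given
by the counters of the list `cube` (with `cube = [0, 2^t)`, `t = |vl| - |pref| - 1`, this is `h`).
[cite: AroraBarakCC2009, §8.3.2 ((8.9))] -/
def hP (φ : CNF ℕ) (vl : List ℕ) (pref : List ℤ) (t : ℕ) (cube : List ℕ) : List ℤ :=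
  psum (cube.map fun c => cnfP vl pref (natBits t c) φ)

/-- **`ofCoeffs (hP …) = h`** for the full cube. [cite: AroraBarakCC2009, §8.3.2 ((8.9))] -/
theorem ofCoeffs_hP (φ : CNF ℕ) (vl : List ℕ) (pref : List ℤ) :
    ofCoeffs (hP φ vl pref (vl.length - pref.length - 1) (List.range (2 ^ (vl.length - pref.length - 1)))) = h φ vl pref := by
  unfold hP h
  rw [ofCoeffs_psum, List.map_map, cubeSum_eq_sum_range]
  congr 1
  refine List.map_congr_left fun c _ => ?_
  simp [ofCoeffs_cnfP]

/-- The fixed-width code of an integer computed with `div`/`mod`. [folklore] -/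
def coeffBits (W : ℕ) (z : ℤ) : List Bool :=
  decide (z < 0) :: (List.range (W - 1)).map fun i => decide (z.natAbs / 2 ^ i % 2 = 1)

/-- `coeffBits = encodeCoeff`. [folklore] -/
theorem coeffBits_eq (W : ℕ) (z : ℤ) : coeffBits W z = encodeCoeff W z := by
  unfold coeffBits encodeCoeff natToWord
  congr 1
  apply List.ext_getElem (by simp)
  intro i h1 h2
  rw [List.getElem_map, List.getElem_range, List.getElem_ofFn, Nat.testBit_eq_decide_div_mod_eq]

/-- The code of a coefficient list: the first `D` coefficients in width `W`, as one bit list. [folklore] -/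
def msgBits (W D : ℕ) (p : List ℤ) : List Bool :=
  ((List.range D).map fun j => coeffBits W (p.getD j 0)).flatten

/-- `msgBits W D p = encodeCoeffs W D (ofCoeffs p)`. [folklore] -/
theorem msgBits_eq_encodeCoeffs (W D : ℕ) (p : List ℤ) : msgBits W D p = encodeCoeffs W D (ofCoeffs p) := by
  unfold msgBits encodeCoeffs
  congr 1
  refine List.map_congr_left fun j _ => ?_
  rw [coeffBits_eq, coeff_ofCoeffs]

/-- **The honest bit with a budget** (what the machine computes on the parsed fields: the budget
string `pad`, the query head `wq` and its decoded CNF `φ`, the coin prefix `pb`, the unary bit index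
`js`): the cube is cut at `|pad|` counters. [cite: AroraBarakCC2009, §8.3.2 ((8.9))] -/
def honestCore (pad wq : List Bool) (φ : CNF ℕ) (pb js : List Bool) : Bool :=
  let n := wq.length
  let vl := varList φ
  let pref := blockVals (chunks (pb.length / blockLen n) (blockLen n) pb)
  let t := vl.length - pref.length - 1
  (msgBits (coeffWidth n) (numCoeffs n) (hP φ vl pref t (List.range (min (2 ^ t) pad.length)))).getD js.length false

/-- The honest bit with a budget, on the raw query string. [folklore] -/
def honestBitB (pad s : List Bool) : Bool :=
  honestCore pad (fstF (fstF s)) (NegCNF.decCNF (fstF (fstF s))) (sndF (fstF s)) (sndF s)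

/-- The items of the total list decoder are no longer than the decoded string. [folklore] -/
theorem length_of_mem_decList {α : Type} (d : List Bool → α) (g : α → ℕ) (hg : ∀ u : List Bool, g (d u) ≤ u.length) :
    ∀ (n : ℕ) (w : List Bool), ∀ a ∈ NegCNF.decList d n w, g a ≤ w.length
  | 0, w, a, ha => by simp [NegCNF.decList] at ha
  | n + 1, w, a, ha => by
    simp only [NegCNF.decList, List.mem_cons] at ha
    have hparts := length_boolUnpair_parts_le w
    rcases ha with rfl | ha
    · exact (hg _).trans (by omega)
    · exact (length_of_mem_decList d g hg n _ a ha).trans (by omega)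

/-- **The size of the CNF read off ANY string is at most quadratic** (`|z|` clauses of `≤ |z|`
literals). [folklore] -/
theorem size_decCNF_le (z : List Bool) : (NegCNF.decCNF z).size ≤ z.length * z.length := by
  have hcl : ∀ u : List Bool, (NegCNF.decClause u).length ≤ u.length := fun u => by
    unfold NegCNF.decClause
    rw [NegCNF.length_decList]
    have := length_boolUnpair_parts_le u
    omega
  unfold NegCNF.decCNF CNF.size
  have hparts := length_boolUnpair_parts_le z
  have hlen : (NegCNF.decList NegCNF.decClause (boolUnpair z).1.length (boolUnpair z).2).length ≤ z.length := by
    rw [NegCNF.length_decList]; omega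
  have hitem : ∀ x ∈ (NegCNF.decList NegCNF.decClause (boolUnpair z).1.length (boolUnpair z).2).map List.length, x ≤ z.length :=
    fun x hx => by
      obtain ⟨c, hc, rfl⟩ := List.mem_map.1 hx
      exact (length_of_mem_decList NegCNF.decClause List.length hcl _ _ c hc).trans (by omega)
  refine (List.sum_le_card_nsmul _ _ hitem).trans ?_
  rw [List.length_map, smul_eq_mul]
  exact Nat.mul_le_mul_right _ hlen

/-- **The budgeted bit is the honest bit** once the budget has length `≥ 2^{|s|²}` (the cube has
`2^t` points with `t ≤ |varList φ| ≤ size φ ≤ |s|²`). [cite: AroraBarakCC2009, §8.3.2 ((8.9))] -/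
theorem honestBitB_eq {pad s : List Bool} (hpad : 2 ^ (s.length ^ 2) ≤ pad.length) : honestBitB pad s = honestBit s := by
  have hwq : (fstF (fstF s)).length ≤ s.length := by
    have h1 := length_fstF_sndF_le s
    have h2 := length_fstF_sndF_le (fstF s)
    omega
  unfold honestBitB honestCore honestBit honestMsgOf
  simp only
  set wq := fstF (fstF s)
  set φ := NegCNF.decCNF wq
  set pref := blockVals (chunks ((sndF (fstF s)).length / blockLen wq.length) (blockLen wq.length) (sndF (fstF s)))
  set t := (varList φ).length - pref.length - 1
  have ht : 2 ^ t ≤ pad.length := by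
    refine le_trans (Nat.pow_le_pow_right (by norm_num) ?_) hpad
    calc t ≤ (varList φ).length := by omega
      _ ≤ φ.size := length_varList_le φ
      _ ≤ wq.length * wq.length := size_decCNF_le wq
      _ ≤ s.length ^ 2 := by rw [sq]; exact Nat.mul_le_mul hwq hwq
  rw [min_eq_left ht, msgBits_eq_encodeCoeffs, ofCoeffs_hP]

/-! ### The index of a variable -/

/-- The position of `v` in `vl` through the enumerated list (program form of `List.idxOf`). [folklore] -/
def idxOfL (vl : List ℕ) (v : ℕ) : ℕ :=
  ((((List.range vl.length).zip vl).filter fun q => decide (q.2 = v)).headD (vl.length, 0)).1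

/-- The enumerated-filter form with an offset. [folklore] -/
theorem idxOf_aux (v : ℕ) : ∀ (vl : List ℕ) (k₀ : ℕ),
    ((((List.range' k₀ vl.length).zip vl).filter fun q => decide (q.2 = v)).headD (k₀ + vl.length, 0)).1 = k₀ + vl.idxOf v
  | [], k₀ => by simp
  | u :: vl, k₀ => by
    rw [List.length_cons, List.range'_succ, List.zip_cons_cons, List.filter_cons]
    by_cases h : u = v
    · subst h
      simp
    · have hne : (decide ((k₀, u).2 = v)) = false := by simp [h]
      rw [hne]
      simp only [Bool.false_eq_true, ↓reduceIte]
      rw [List.idxOf_cons_ne _ h, show k₀ + (vl.length + 1) = (k₀ + 1) + vl.length by omega,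
        idxOf_aux v vl (k₀ + 1)]
      omega

/-- **`idxOfL = List.idxOf`.** [folklore] -/
theorem idxOfL_eq (vl : List ℕ) (v : ℕ) : idxOfL vl v = vl.idxOf v := by
  have := idxOf_aux v vl 0
  simp only [zero_add] at this
  rw [← this, idxOfL, List.range_eq_range']

/-! ### The program: polynomial arithmetic of the prover -/

/-- The context of the arithmetization: variable list, prefix values, cube point. [folklore] -/
abbrev CtxL : Type := List ℕ × List ℤ × List ℤ

/-- Code of the arithmetization context. [folklore] -/
abbrev ctxLE : CtxL → List Bool := pairE (rawE natE) (pairE (rawE intE) (rawE intE))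

/-- `1 - p` on codes. [folklore] -/
theorem oneSubPC : CodeFP (rawE intE) (rawE intE) oneSubP :=
  (paddC.comp ((const _ ([1] : List ℤ)).pair (pscaleC.comp ((const _ (-1 : ℤ)).pair (CodeFP.id _)))) :)

/-- **The index of a variable** on codes. [folklore] -/
theorem idxOfC : CodeFP (pairE (rawE natE) natE) natE (fun p => p.1.idxOf p.2) := by
  have hp : CodeFP (pairE natE (pairE natE natE)) bitE (fun t => decide (t.2.2 = t.1)) :=
    (natEq.comp ((snd _ _).snd'.pair (fst _ _)) :)
  have hf : CodeFP (pairE natE (rawE (pairE natE natE))) (rawE (pairE natE natE))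
      (fun q => q.2.filter fun a => decide (a.2 = q.1)) := filter hp
  have henum : CodeFP (pairE (rawE natE) natE) (rawE (pairE natE natE)) (fun p => (List.range p.1.length).zip p.1) :=
    ((rawEnum natE).comp (fst _ _) :)
  have hfilt : CodeFP (pairE (rawE natE) natE) (rawE (pairE natE natE))
      (fun p => ((List.range p.1.length).zip p.1).filter fun a => decide (a.2 = p.2)) :=
    (hf.comp ((snd _ _).pair henum) :)
  have hdef : CodeFP (pairE (rawE natE) natE) (pairE natE natE) (fun p => (p.1.length, (0 : ℕ))) :=
    (((natLength natE).comp (fst _ _)).pair (const _ (0 : ℕ)) :)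
  have hhead : CodeFP (pairE (rawE natE) natE) (pairE natE natE)
      (fun p => (((List.range p.1.length).zip p.1).filter fun a => decide (a.2 = p.2)).headD (p.1.length, 0)) :=
    ((rawHeadOr (pairE natE natE)).comp (hdef.pair hfilt) :)
  exact hhead.fst'.congr fun p => by rw [← idxOfL_eq]; rfl

/-- **A coordinate of the point with a hole** on codes. [cite: AroraBarakCC2009, §8.3.2 ((8.9))] -/
theorem coordPC : CodeFP (pairE ctxLE natE) (rawE intE) (fun p => coordP p.1.1 p.1.2.1 p.1.2.2 p.2) := by
  have hvl : CodeFP (pairE ctxLE natE) (rawE natE) (fun p => p.1.1) := (fst _ _).fst'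
  have hpref : CodeFP (pairE ctxLE natE) (rawE intE) (fun p => p.1.2.1) := (fst _ _).snd'.fst'
  have hxs : CodeFP (pairE ctxLE natE) (rawE intE) (fun p => p.1.2.2) := (fst _ _).snd'.snd'
  have hv : CodeFP (pairE ctxLE natE) natE (fun p => p.2) := snd _ _
  have hidx : CodeFP (pairE ctxLE natE) natE (fun p => p.1.1.idxOf p.2) := (idxOfC.comp (hvl.pair hv) :)
  have hlen : CodeFP (pairE ctxLE natE) natE (fun p => p.1.2.1.length) := ((natLength intE).comp hpref :)
  have hlt : CodeFP (pairE ctxLE natE) bitE (fun p => decide (p.1.1.idxOf p.2 < p.1.2.1.length)) := (natLt.comp (hidx.pair hlen) :)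
  have heq : CodeFP (pairE ctxLE natE) bitE (fun p => decide (p.1.1.idxOf p.2 = p.1.2.1.length)) := (natEq.comp (hidx.pair hlen) :)
  have hget1 : CodeFP (pairE ctxLE natE) intE (fun p => p.1.2.1.getD (p.1.1.idxOf p.2) 0) :=
    ((rawGetOr intE).comp (hpref.pair (hidx.pair (const _ (0 : ℤ)))) :)
  have hsub : CodeFP (pairE ctxLE natE) natE (fun p => p.1.1.idxOf p.2 - p.1.2.1.length - 1) :=
    (natSub.comp ((natSub.comp (hidx.pair hlen)).pair (const _ (1 : ℕ))) :)
  have hget2 : CodeFP (pairE ctxLE natE) intE (fun p => p.1.2.2.getD (p.1.1.idxOf p.2 - p.1.2.1.length - 1) 0) :=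
    ((rawGetOr intE).comp (hxs.pair (hsub.pair (const _ (0 : ℤ)))) :)
  have hs1 : CodeFP (pairE ctxLE natE) (rawE intE) (fun p => [p.1.2.1.getD (p.1.1.idxOf p.2) 0]) := ((rawSingleton intE).comp hget1 :)
  have hs2 : CodeFP (pairE ctxLE natE) (rawE intE) (fun p => [p.1.2.2.getD (p.1.1.idxOf p.2 - p.1.2.1.length - 1) 0]) :=
    ((rawSingleton intE).comp hget2 :)
  exact (hlt.ite hs1 (heq.ite (const _ ([0, 1] : List ℤ)) hs2)).congr fun p => by
    unfold coordP
    by_cases h1 : p.1.1.idxOf p.2 < p.1.2.1.length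
    · rw [decide_eq_true h1, if_pos rfl, if_pos h1]
    · rw [decide_eq_false h1, if_neg h1]
      by_cases h2 : p.1.1.idxOf p.2 = p.1.2.1.length
      · rw [decide_eq_true h2, if_pos h2]; rfl
      · rw [decide_eq_false h2, if_neg h2]; rfl

/-- **A literal** on codes. [cite: AroraBarakCC2009, §8.3.1] -/
theorem litPC : CodeFP (pairE ctxLE litE) (rawE intE) (fun p => litP p.1.1 p.1.2.1 p.1.2.2 p.2) := by
  have hcoord : CodeFP (pairE ctxLE litE) (rawE intE) (fun p => coordP p.1.1 p.1.2.1 p.1.2.2 p.2.1) :=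
    (coordPC.comp ((fst _ _).pair (snd _ _).fst') :)
  have hneg : CodeFP (pairE ctxLE litE) (rawE intE) (fun p => oneSubP (coordP p.1.1 p.1.2.1 p.1.2.2 p.2.1)) := (oneSubPC.comp hcoord :)
  exact ((snd _ _).snd'.ite hcoord hneg).congr fun p => by unfold litP; rfl

/-- **A clause** on codes. [cite: AroraBarakCC2009, §8.3.1] -/
theorem clausePC : CodeFP (pairE ctxLE (rawE litE)) (rawE intE) (fun p => clauseP p.1.1 p.1.2.1 p.1.2.2 p.2) := by
  have hitem : CodeFP (pairE ctxLE litE) (rawE intE) (fun p => oneSubP (litP p.1.1 p.1.2.1 p.1.2.2 p.2)) := (oneSubPC.comp litPC :)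
  have hmap : CodeFP (pairE ctxLE (rawE litE)) (rawE (rawE intE)) (fun p => p.2.map fun l => oneSubP (litP p.1.1 p.1.2.1 p.1.2.2 l)) :=
    map hitem
  exact (oneSubPC.comp (pprodC.comp hmap)).congr fun p => by unfold clauseP; rfl

/-- **`P_φ`** on codes (the CNF in raw code). [cite: AroraBarakCC2009, §8.3.1] -/
theorem cnfPC : CodeFP (pairE ctxLE cnfRawE) (rawE intE) (fun p => cnfP p.1.1 p.1.2.1 p.1.2.2 p.2) := by
  have hmap : CodeFP (pairE ctxLE cnfRawE) (rawE (rawE intE)) (fun p => p.2.map (clauseP p.1.1 p.1.2.1 p.1.2.2)) := map clausePC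
  exact (pprodC.comp hmap).congr fun p => by unfold cnfP; rfl

/-- **The bits of a counter** on codes: `(1ᵗ, c) ↦ natBits t c`. [folklore] -/
theorem natBitsC : CodeFP (pairE unE natE) (rawE intE) (fun p => natBits p.1 p.2) := by
  -- context `(c, 1ᵗ)`, item `j`
  have hc : CodeFP (pairE (pairE natE unE) natE) natE (fun q => q.1.1) := (fst _ _).fst'
  have ht : CodeFP (pairE (pairE natE unE) natE) unE (fun q => q.1.2) := (fst _ _).snd'
  have hj : CodeFP (pairE (pairE natE unE) natE) natE (fun q => q.2) := snd _ _
  have hpow : CodeFP (pairE (pairE natE unE) natE) natE (fun q => 2 ^ min q.2 q.1.2) :=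
    (natPow.comp ((const _ (2 : ℕ)).pair (unOfNatMin.comp (ht.pair hj))) :)
  have hbit : CodeFP (pairE (pairE natE unE) natE) bitE (fun q => decide (q.1.1 / 2 ^ min q.2 q.1.2 % 2 = 1)) :=
    (natEq.comp ((natMod.comp ((natDiv.comp (hc.pair hpow)).pair (const _ (2 : ℕ)))).pair (const _ (1 : ℕ))) :)
  have hval : CodeFP (pairE (pairE natE unE) natE) intE (fun q => if q.1.1 / 2 ^ min q.2 q.1.2 % 2 = 1 then (1 : ℤ) else 0) :=
    (hbit.ite (const _ (1 : ℤ)) (const _ (0 : ℤ))).congr fun q => by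
      by_cases h : q.1.1 / 2 ^ min q.2 q.1.2 % 2 = 1
      · rw [decide_eq_true h, if_pos rfl, if_pos h]
      · rw [decide_eq_false h, if_neg h]; rfl
  have hmap := map (σ := ℕ × ℕ) (eσ := pairE natE unE) (g := fun q : (ℕ × ℕ) × ℕ => if q.1.1 / 2 ^ min q.2 q.1.2 % 2 = 1 then (1 : ℤ) else 0) hval
  have hall : CodeFP (pairE unE natE) (rawE intE)
      (fun p => (List.range p.1).map fun j => if p.2 / 2 ^ min j p.1 % 2 = 1 then (1 : ℤ) else 0) :=
    (hmap.comp (((snd _ _).pair (fst _ _)).pair (urange.comp (fst _ _))) :)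
  refine hall.congr fun p => ?_
  unfold natBits
  refine List.map_congr_left fun j hj => ?_
  rw [min_eq_left (List.mem_range.1 hj).le]

/-- The context of the cube sum: CNF (raw), variable list, prefix values, `1ᵗ`. [folklore] -/
abbrev CtxH : Type := CNF ℕ × List ℕ × List ℤ × ℕ

/-- Code of the cube context. [folklore] -/
abbrev ctxHE : CtxH → List Bool := pairE cnfRawE (pairE (rawE natE) (pairE (rawE intE) unE))

/-- **The honest polynomial** on codes: `(context, cube) ↦ hP φ vl pref t cube`. [cite: AroraBarakCC2009, §8.3.2 ((8.9))] -/
theorem hPC : CodeFP (pairE ctxHE (rawE natE)) (rawE intE) (fun p => hP p.1.1 p.1.2.1 p.1.2.2.1 p.1.2.2.2 p.2) := by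
  have hφ : CodeFP (pairE ctxHE natE) cnfRawE (fun q => q.1.1) := (fst _ _).fst'
  have hvl : CodeFP (pairE ctxHE natE) (rawE natE) (fun q => q.1.2.1) := (fst _ _).snd'.fst'
  have hpref : CodeFP (pairE ctxHE natE) (rawE intE) (fun q => q.1.2.2.1) := (fst _ _).snd'.snd'.fst'
  have ht : CodeFP (pairE ctxHE natE) unE (fun q => q.1.2.2.2) := (fst _ _).snd'.snd'.snd'
  have hc : CodeFP (pairE ctxHE natE) natE (fun q => q.2) := snd _ _
  have hxs : CodeFP (pairE ctxHE natE) (rawE intE) (fun q => natBits q.1.2.2.2 q.2) := (natBitsC.comp (ht.pair hc) :)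
  have hitem : CodeFP (pairE ctxHE natE) (rawE intE) (fun q => cnfP q.1.2.1 q.1.2.2.1 (natBits q.1.2.2.2 q.2) q.1.1) :=
    (cnfPC.comp ((hvl.pair (hpref.pair hxs)).pair hφ) :)
  have hmap := map hitem
  exact (psumC.comp hmap).congr fun p => by unfold hP; rfl

/-- `1ᵂ ↦ 1^{W-1}`. [folklore] -/
theorem unPred : CodeFP unE unE (fun W => W - 1) :=
  (unOfNatMin.comp ((CodeFP.id unE).pair (natSub.comp (natOfUn.pair (const _ (1 : ℕ)))))).congr fun W => by
    change min (W - 1) W = W - 1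
    exact min_eq_left (Nat.sub_le _ _)

/-- **The fixed-width code of an integer** on codes: `(1ᵂ, z) ↦ coeffBits W z` (as a bit list). [folklore] -/
theorem coeffBitsC : CodeFP (pairE unE intE) (rawE bitE) (fun p => coeffBits p.1 p.2) := by
  -- the magnitude bits: context `(|z|, 1^{W-1})`, item `i`
  have ha : CodeFP (pairE (pairE natE unE) natE) natE (fun q => q.1.1) := (fst _ _).fst'
  have hcap : CodeFP (pairE (pairE natE unE) natE) unE (fun q => q.1.2) := (fst _ _).snd'
  have hi : CodeFP (pairE (pairE natE unE) natE) natE (fun q => q.2) := snd _ _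
  have hpow : CodeFP (pairE (pairE natE unE) natE) natE (fun q => 2 ^ min q.2 q.1.2) :=
    (natPow.comp ((const _ (2 : ℕ)).pair (unOfNatMin.comp (hcap.pair hi))) :)
  have hbit : CodeFP (pairE (pairE natE unE) natE) bitE (fun q => decide (q.1.1 / 2 ^ min q.2 q.1.2 % 2 = 1)) :=
    (natEq.comp ((natMod.comp ((natDiv.comp (ha.pair hpow)).pair (const _ (2 : ℕ)))).pair (const _ (1 : ℕ))) :)
  have hmap := map (σ := ℕ × ℕ) (eσ := pairE natE unE) (g := fun q : (ℕ × ℕ) × ℕ => decide (q.1.1 / 2 ^ min q.2 q.1.2 % 2 = 1)) hbit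
  have hmag : CodeFP (pairE unE intE) (rawE bitE)
      (fun p => (List.range (p.1 - 1)).map fun i => decide (p.2.natAbs / 2 ^ min i (p.1 - 1) % 2 = 1)) :=
    (hmap.comp ((((intNatAbs.comp (snd _ _)).pair (unPred.comp (fst _ _))).pair (urange.comp (unPred.comp (fst _ _))))) :)
  have hsign : CodeFP (pairE unE intE) bitE (fun p => decide (p.2 < 0)) := (intLt.comp ((snd _ _).pair (const _ (0 : ℤ))) :)
  refine (((rawCons bitE).comp (hsign.pair hmag))).congr fun p => ?_
  unfold coeffBits
  congr 1
  refine List.map_congr_left fun i hi => ?_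
  rw [min_eq_left (List.mem_range.1 hi).le]

/-- **The code of a coefficient list** on codes: `(1ᵂ, 1ᴰ, p) ↦ msgBits W D p`. [folklore] -/
theorem msgBitsC : CodeFP (pairE unE (pairE unE (rawE intE))) (rawE bitE) (fun p => msgBits p.1 p.2.1 p.2.2) := by
  -- context `(1ᵂ, p)`, item `j`
  have hW : CodeFP (pairE (pairE unE (rawE intE)) natE) unE (fun q => q.1.1) := (fst _ _).fst'
  have hp : CodeFP (pairE (pairE unE (rawE intE)) natE) (rawE intE) (fun q => q.1.2) := (fst _ _).snd'
  have hj : CodeFP (pairE (pairE unE (rawE intE)) natE) natE (fun q => q.2) := snd _ _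
  have hz : CodeFP (pairE (pairE unE (rawE intE)) natE) intE (fun q => q.1.2.getD q.2 0) :=
    ((rawGetOr intE).comp (hp.pair (hj.pair (const _ (0 : ℤ)))) :)
  have hitem : CodeFP (pairE (pairE unE (rawE intE)) natE) (rawE bitE) (fun q => coeffBits q.1.1 (q.1.2.getD q.2 0)) :=
    (coeffBitsC.comp (hW.pair hz) :)
  have hmap := map hitem
  have hall : CodeFP (pairE unE (pairE unE (rawE intE))) (rawE (rawE bitE))
      (fun p => (List.range p.2.1).map fun j => coeffBits p.1 (p.2.2.getD j 0)) :=
    (hmap.comp (((fst _ _).pair (snd _ _).snd').pair (urange.comp (snd _ _).fst')) :)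
  exact ((flatten bitE).comp hall).congr fun p => by unfold msgBits; rfl

/-! ### The program: the honest bit with a budget -/

/-- Code of the parsed padded query: budget, query head, its CNF, coin prefix, unary bit index. [folklore] -/
abbrev honE : (List Bool × List Bool × CNF ℕ × List Bool × List Bool) → List Bool :=
  pairE strE (pairE strE (pairE cnfE (pairE strE strE)))

/-- **The honest bit with a budget is polynomial time** in the parsed padded query.
[cite: AroraBarakCC2009, §8.4 (item 2: the power needed by the prover) and §2.6.2 (padding)] -/
theorem honestCoreC : CodeFP honE bitE (fun p => honestCore p.1 p.2.1 p.2.2.1 p.2.2.2.1 p.2.2.2.2) := by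
  have hpad : CodeFP honE strE (fun p => p.1) := fst _ _
  have hwq : CodeFP honE strE (fun p => p.2.1) := (snd _ _).fst'
  have hφ : CodeFP honE cnfRawE (fun p => p.2.2.1) := (cnfRawOfList.comp (snd _ _).snd'.fst' :)
  have hpb : CodeFP honE strE (fun p => p.2.2.2.1) := (snd _ _).snd'.snd'.fst'
  have hjs : CodeFP honE strE (fun p => p.2.2.2.2) := (snd _ _).snd'.snd'.snd'
  have hℓ : CodeFP honE unE (fun p => blockLen p.2.1.length) := ((polyU (2 * X + 2)).comp hwq).congr fun p => eval_blockLenPoly _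
  have hD : CodeFP honE unE (fun p => numCoeffs p.2.1.length) := ((polyU (X + 1)).comp hwq).congr fun p => eval_numCoeffsPoly _
  have hW : CodeFP honE unE (fun p => coeffWidth p.2.1.length) :=
    ((polyU ((2 * X + 7) * X + 2)).comp hwq).congr fun p => eval_coeffWidthPoly _
  -- number of blocks `i = |pb| / ℓ`, in unary through the cap `|pb|`
  have hi : CodeFP honE natE (fun p => p.2.2.2.1.length / blockLen p.2.1.length) :=
    (natDiv.comp ((strNatLength.comp hpb).pair (natOfUn.comp hℓ)) :)
  have hiu : CodeFP honE unE (fun p => p.2.2.2.1.length / blockLen p.2.1.length) :=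
    (unOfNatMin.comp ((strLength.comp hpb).pair hi)).congr fun p => min_eq_left (Nat.div_le_self _ _)
  have hpref : CodeFP honE (rawE intE) (fun p => blockVals (chunks (p.2.2.2.1.length / blockLen p.2.1.length) (blockLen p.2.1.length) p.2.2.2.1)) :=
    ((map₀ (intOfNat.comp strVal)).comp (strChunks.comp (hiu.pair (hℓ.pair hpb)))).congr fun p => rfl
  have hvl : CodeFP honE (rawE natE) (fun p => varList p.2.2.1) := (varListC.comp hφ :)
  have hk : CodeFP honE unE (fun p => (varList p.2.2.1).length) := ((ulength natE).comp hvl :)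
  -- `t = k - i - 1`, in unary through the cap `k`
  have htn : CodeFP honE natE (fun p => (varList p.2.2.1).length -
      (blockVals (chunks (p.2.2.2.1.length / blockLen p.2.1.length) (blockLen p.2.1.length) p.2.2.2.1)).length - 1) :=
    (natSub.comp ((natSub.comp ((natOfUn.comp hk).pair ((natLength intE).comp hpref))).pair (const _ (1 : ℕ))) :)
  have htu : CodeFP honE unE (fun p => (varList p.2.2.1).length -
      (blockVals (chunks (p.2.2.2.1.length / blockLen p.2.1.length) (blockLen p.2.1.length) p.2.2.2.1)).length - 1) :=
    (unOfNatMin.comp (hk.pair htn)).congr fun p => min_eq_left (by omega)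
  have hpow : CodeFP honE natE (fun p => 2 ^ ((varList p.2.2.1).length -
      (blockVals (chunks (p.2.2.2.1.length / blockLen p.2.1.length) (blockLen p.2.1.length) p.2.2.2.1)).length - 1)) :=
    (natPow.comp ((const _ (2 : ℕ)).pair htu) :)
  -- the budget list: the bits of the pad, and the cube of counters
  have hpadL : CodeFP honE (rawE strE) (fun p => (List.range p.1.length).map fun i => (p.1.drop (i * 1)).take 1) :=
    (strChunks.comp ((strLength.comp hpad).pair ((const _ (1 : ℕ)).pair hpad)) :)
  have hcube : CodeFP honE (rawE natE) (fun p => List.range (min (2 ^ ((varList p.2.2.1).length -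
      (blockVals (chunks (p.2.2.2.1.length / blockLen p.2.1.length) (blockLen p.2.1.length) p.2.2.2.1)).length - 1)) p.1.length)) :=
    ((brange strE).comp (hpadL.pair hpow)).congr fun p => by simp
  have hctx : CodeFP honE ctxHE (fun p => (p.2.2.1, varList p.2.2.1,
      blockVals (chunks (p.2.2.2.1.length / blockLen p.2.1.length) (blockLen p.2.1.length) p.2.2.2.1),
      (varList p.2.2.1).length -
        (blockVals (chunks (p.2.2.2.1.length / blockLen p.2.1.length) (blockLen p.2.1.length) p.2.2.2.1)).length - 1)) :=
    (hφ.pair (hvl.pair (hpref.pair htu)) :)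
  have hhp := (hPC.comp (hctx.pair hcube) :)
  have hbits := (msgBitsC.comp (hW.pair (hD.pair hhp)) :)
  have hres := ((rawGetOr bitE).comp (hbits.pair ((strNatLength.comp hjs).pair (const _ false))) :)
  exact hres.congr fun p => by unfold honestCore; rfl

/-! ### `HonestLang ∈ EXP` -/

/-- **The language of padded queries**: the budget is the leading block of `1`s, the query the word
after its terminator (`SplitOnesBricks.lean`). [cite: AroraBarakCC2009, Thm. 2.22 (proof: padding)] -/
def HonestPad : Language Bool :=
  {u | honestBitB (onesPrefixFn u) (afterZeroFn u) = true}

/-- Unfolding membership in `HonestPad`. [folklore] -/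
theorem mem_HonestPad_iff (u : List Bool) : u ∈ HonestPad ↔ honestBitB (onesPrefixFn u) (afterZeroFn u) = true := Iff.rfl

/-- **The padded-query language is decided in polynomial time.** [cite: AroraBarakCC2009, §2.6.2 (padding) and §8.4] -/
theorem exists_honestPadFn : ∃ F ∈ FP, ∀ u : List Bool, F u = [honestBitB (onesPrefixFn u) (afterZeroFn u)] := by
  obtain ⟨Hf, hHf, hHfs⟩ := honestCoreC
  have hHfs' : ∀ (pad wq : List Bool) (φ : CNF ℕ) (pb js : List Bool),
      Hf (boolPair pad (boolPair wq (boolPair (cnfE φ) (boolPair pb js)))) = [honestCore pad wq φ pb js] :=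
    fun pad wq φ pb js => hHfs (pad, wq, φ, pb, js)
  have hs : afterZeroFn ∈ FP := afterZeroFn_mem_FP
  have hwq : (fstF ∘ fstF ∘ afterZeroFn) ∈ FP := comp_mem_FP fstF_mem_FP (comp_mem_FP fstF_mem_FP hs)
  have hpb : (sndF ∘ fstF ∘ afterZeroFn) ∈ FP := comp_mem_FP sndF_mem_FP (comp_mem_FP fstF_mem_FP hs)
  have hjs : (sndF ∘ afterZeroFn) ∈ FP := comp_mem_FP sndF_mem_FP hs
  have hbuild : fanoutFn onesPrefixFn (fanoutFn (fstF ∘ fstF ∘ afterZeroFn) (fanoutFn (KSATRed.canonCNFFn ∘ (fstF ∘ fstF ∘ afterZeroFn))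
      (fanoutFn (sndF ∘ fstF ∘ afterZeroFn) (sndF ∘ afterZeroFn)))) ∈ FP :=
    fanoutFn_mem_FP onesPrefixFn_mem_FP (fanoutFn_mem_FP hwq (fanoutFn_mem_FP (comp_mem_FP KSATRed.canonCNFFn_mem_FP hwq)
      (fanoutFn_mem_FP hpb hjs)))
  refine ⟨Hf ∘ fanoutFn onesPrefixFn (fanoutFn (fstF ∘ fstF ∘ afterZeroFn) (fanoutFn (KSATRed.canonCNFFn ∘ (fstF ∘ fstF ∘ afterZeroFn))
      (fanoutFn (sndF ∘ fstF ∘ afterZeroFn) (sndF ∘ afterZeroFn)))), comp_mem_FP hHf hbuild, fun u => ?_⟩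
  simp only [Function.comp_apply, fanoutFn_apply]
  rw [KSATRed.canonCNFFn_eq, cnfE_eq, hHfs']
  rfl

/-- `HonestPad ∈ P`. [cite: AroraBarakCC2009, §2.6.2 and §8.4] -/
theorem HonestPad_mem_P : HonestPad ∈ Classes.P := by
  obtain ⟨F, hF, hFu⟩ := exists_honestPadFn
  refine mem_P_of_mem_FP hF HonestPad fun u => ⟨fun hu => ?_, fun hu => ?_⟩
  · rw [hFu, (mem_HonestPad_iff u).1 hu]
  · rw [hFu]
    rw [mem_HonestPad_iff, Bool.not_eq_true] at hu
    rw [hu]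

/-- **The honest sumcheck prover's bit-graph language is in `EXP`** (translation upward from the
polynomial-time decision of the padded queries `1^{2^{|s|²}} 0 s`, `ExpPadding.mem_EXP_of_expPad`).
[cite: AroraBarakCC2009, §8.4 (item 2) and Thm. 2.22 (padding)] -/
theorem honestLang_mem_EXP : HonestLang ∈ EXP := by
  refine mem_EXP_of_expPad (k := 2) (by norm_num) (fun s => ?_) HonestPad_mem_P
  rw [mem_HonestLang_iff, mem_HonestPad_iff, expPad, show List.replicate (2 ^ (s.length ^ 2)) true = ones (2 ^ (s.length ^ 2)) from rfl,
    onesPrefixFn_ones_append, afterZeroFn_ones_append, honestBitB_eq]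
  simp [ones]

/-- **`EXP ⊆ P/poly ⟹ UNSAT ∈ MA`**: under the hypothesis the honest prover's bit graph (`∈ EXP`) has
polynomial-size circuits, and the Merlin–Arthur simulation of the sumcheck protocol applies
(`UNSAT_mem_MA_of_honestLang_mem_PPoly`). [cite: AroraBarakCC2009, Lemma 20.18 (proof)] -/
theorem UNSAT_mem_MA_of_EXP_subset_PPoly (h : EXP ⊆ PPoly) : UNSAT ∈ MA :=
  UNSAT_mem_MA_of_honestLang_mem_PPoly (h honestLang_mem_EXP)

end SumcheckMA

end Literature.Computability.Complexity

end
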